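import Summits.CriticalPhenomena.CardyFormulaZ2.Theorems.CardySelfRefinementLagHandOffKernelBoundaryNear
import Literature.Probability.LatticeModels.DobrushinDiscretisation
import Literature.Probability.RandomPlanarGeometry.PlanarDomains
import Mathlib.Topology.MetricSpace.HausdorffDistance
import HarnessLib

/-!
# Sites of the discrete boundary of a discretisation family are `2δ`-close to `∂D`

Crux `LagHandOff` (line hitting-tournament), kernel infrastructure: for a
`ZdDiscretisationFamily D E` and `δ > 0`, every site `x ∈ (E δ).zdBoundary` has
`infDist (δx) (frontier D) ≤ 2δ`, so "the exploration touches the boundary" happens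
`O(δ)`-close to `∂D`.  Family form of the per-data theorem `stub_kernel_zdBoundary_near_frontier`
(`…LagHandOffKernelBoundaryNear.lean`: `infDist (δz) (frontier E.Ω) < 2 E.δ` for data with
positive mesh and open domain), via `hE.Ω_eq`, `hE.δ_eq` and `D.isOpen`.
-/

noncomputable section

open MeasureTheory Filter Set Topology
open Literature.Probability.Percolation Literature.Probability.LatticeModels
open Literature.Probability.RandomPlanarGeometry

namespace Summit.CriticalPhenomena.CardyFormulaZ2.Cruxes.LagHandOff.HittingTournament

/-- **Sites of the discrete boundary are `2δ`-close to the topological boundary (family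
form).** For a discretisation family `E` of the Dobrushin domain `D` and a positive mesh `δ`,
every site `x` of `(E δ).zdBoundary` (a vertex-boundary site of `Ω_δ` or an endpoint of a
face-boundary edge) has `infDist (meshPoint δ x) (frontier D.carrier) ≤ 2δ`: the domain of the
data is the open set `D.carrier` and its mesh is `δ` (`ZdDiscretisationFamily.Ω_eq`, `δ_eq`),
so the per-data bound `stub_kernel_zdBoundary_near_frontier` (`< 2 E.δ`; Smirnov 2001, §2: the
discrete boundary approximates `∂Ω`) applies. -/
theorem stub_kernel_zdBoundary_near_frontier_family :
    ∀ (D : DobrushinDomain) (E : ℝ → DiscreteDobrushin), ZdDiscretisationFamily D E →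
      ∀ δ : ℝ, 0 < δ → ∀ x ∈ (E δ).zdBoundary,
        Metric.infDist (meshPoint δ x) (frontier D.carrier) ≤ 2 * δ := by
  intro D E hE δ hδ x hx
  have hδ' : 0 < (E δ).δ := by rw [hE.δ_eq δ]; exact hδ
  have hΩ : IsOpen (E δ).Ω := by rw [hE.Ω_eq δ]; exact D.isOpen
  have h := stub_kernel_zdBoundary_near_frontier (E δ) hδ' hΩ x hx
  rw [hE.Ω_eq δ, hE.δ_eq δ] at h
  exact h.le

end Summit.CriticalPhenomena.CardyFormulaZ2.Cruxes.LagHandOff.HittingTournament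

end
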